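import Literature.Computability.Complexity.UmansFPGenEval
import Mathlib.Analysis.SpecialFunctions.Pow.Real
import HarnessLib

/-!
# Umans' generator: the parameters and their inequalities

Literature / circuit complexity — derandomization. C. Umans, JCSS 67 (2003), §5 ("choice of
parameters") fixes `h, q = h^{c₀}, d, r, …` as functions of `n` (table length) and `m` (target
length) so that the reconstruction theorem (Thm. 14) applies with list size `poly(m)` and success
density `ρ = 1/m²`. This file makes one such choice explicit for the program's parameter functions
`aOf`, `MOf 16`, `dOf 16` of `UmansFPGenEval.lean` (`c₀ = 16`, `q = h¹⁶ = q₀²`) and proves the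
(many, elementary) inequalities consumed by `thm14_advice`, `predLT_spec`, `recon_correct` and
`exists_dense_predictor`, in the regime `m ≥ m₀`, `log₂ n ≤ m/4` of the final argument.

Everything is proved; no named fact.

## References

* C. Umans, *Pseudo-random generators for all hardnesses*, JCSS 67 (2003), §5 (choice of
  parameters), Lemma 13, Thm. 14 [Umans2003].
-/

noncomputable section

namespace Literature.Computability.Complexity

open Finset

namespace UmansFP

namespace Prm

/-! ### The parameters -/

/-- `c₀ = 16`. [cite: Umans2003, §5] -/
def c0 : ℕ := 16

/-- `a` with `h = 2ᵃ ∈ [m+2, 2m+4)`. [cite: Umans2003, §5] -/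
def aP (m : ℕ) : ℕ := aOf m
/-- `h = 2ᵃ`. [cite: Umans2003, §5] -/
def hP (m : ℕ) : ℕ := 2 ^ aP m
/-- `M = 16 a - 1`. [cite: Umans2003, §5] -/
def MP (m : ℕ) : ℕ := MOf c0 m
/-- `q = 2^{M+1} = h¹⁶`. [cite: Umans2003, §5] -/
def qP (m : ℕ) : ℕ := 2 ^ (MP m + 1)
/-- `q₀ = h⁸ = √q`. [cite: Umans2003, §5] -/
def q0 (m : ℕ) : ℕ := hP m ^ 8
/-- `d` (a prime `≥ 17` with `hᵈ > n`). [cite: Umans2003, §5, Lemma 7] -/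
def dP (n m : ℕ) : ℕ := dOf c0 n m
/-- `r' = 2d + 6` (nodes per curve row). [cite: Umans2003, §6.1] -/
def r'P (n m : ℕ) : ℕ := 2 * dP n m + 6
/-- `k = (d+1)(d+3) = r/2`. [cite: Umans2003, §6.1] -/
def kP (n m : ℕ) : ℕ := (dP n m + 1) * (dP n m + 3)
/-- `Dφ = d (h - 1)` (curve degree of `Ẽ`'s coordinates). [cite: Umans2003, Thm. 8 (P1)] -/
def DφP (n m : ℕ) : ℕ := dP n m * (hP m - 1)
/-- `D = Dφ ((d+1) r' - 1)` (degree along reference curves). [cite: Umans2003, §6.2] -/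
def DP (n m : ℕ) : ℕ := DφP n m * ((dP n m + 1) * r'P n m - 1)
/-- `A₁ = A = ⌊q/(4m²)⌋` (agreement thresholds). [cite: Umans2003, Lemma 13, §6.2] -/
def AP (m : ℕ) : ℕ := qP m / (4 * m ^ 2)
/-- `D₁ = ⌊q/(4m²)⌋` (Hadamard threshold). [cite: Umans2003, Lemma 13] -/
def D1 (m : ℕ) : ℕ := qP m / (4 * m ^ 2)
/-- `ℓ₁ = 18 m⁴` (inner list bound, `≥ 4^{M+1}/D₁²`). [cite: Umans2003, Lemma 13] -/
def ℓ1 (m : ℕ) : ℕ := 18 * m ^ 4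
/-- `J₁ = 128 m⁶` (inner Sudan `Y`-degree). [cite: Umans2003, Lemma 13] -/
def J1 (m : ℕ) : ℕ := 128 * m ^ 6
/-- `I₁ = A₁ - J₁ d` (inner Sudan `X`-degree). [cite: Umans2003, Lemma 13] -/
def I1 (n m : ℕ) : ℕ := AP m - J1 m * dP n m
/-- `J = 2048 m⁸` (outer Sudan `Y`-degree). [cite: Umans2003, Lemma 15] -/
def JO (m : ℕ) : ℕ := 2048 * m ^ 8
/-- `I = A - J D` (outer Sudan `X`-degree). [cite: Umans2003, Lemma 15] -/
def IO (n m : ℕ) : ℕ := AP m - JO m * DP n m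

/-- **The regime of the main argument**: `m ≥ m₀ = 2²⁰` and `log₂ n ≤ m / 4`. [cite: Umans2003, §5] -/
structure Regime (n m : ℕ) : Prop where
  hm : 2 ^ 20 ≤ m
  hn : Nat.log 2 n ≤ m / 4

/-! ### `a`, `h`, `q` -/

/-- `h ≥ m + 2`. [cite: Umans2003, §5] -/
theorem m_add_two_le_h (m : ℕ) : m + 2 ≤ hP m := (clog2L_spec (m + 2)).1

/-- `h < 2 (m + 2)` (minimality of `a`). [cite: Umans2003, §5] -/
theorem h_lt (m : ℕ) : hP m < 2 * (m + 2) := by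
  rw [hP, aP, aOf]
  obtain ⟨-, hmin⟩ := clog2L_spec (m + 2)
  -- `a - 1` is too small
  by_contra hge
  push Not at hge
  rcases Nat.eq_zero_or_pos (clog2L (m + 2)) with h0 | hpos
  · rw [h0, pow_zero] at hge; omega
  · have := hmin (clog2L (m + 2) - 1) (by
      have e : 2 ^ clog2L (m + 2) = 2 * 2 ^ (clog2L (m + 2) - 1) := by rw [← pow_succ', Nat.sub_add_cancel hpos]
      rw [e] at hge; omega)
    omega

/-- `a ≥ 1`. [folklore] -/
theorem one_le_a (m : ℕ) : 1 ≤ aP m := by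
  by_contra h0
  have : aP m = 0 := by omega
  have h := m_add_two_le_h m
  rw [hP, this, pow_zero] at h; omega

/-- `M + 1 = 16 a`. [folklore] -/
theorem M_succ (m : ℕ) : MP m + 1 = aP m * c0 := by
  rw [MP, MOf, aP, c0]; have := one_le_a m; rw [aP] at this; omega

/-- `q = h¹⁶`. [cite: Umans2003, §5] -/
theorem q_eq (m : ℕ) : qP m = hP m ^ 16 := by rw [qP, M_succ, hP, ← pow_mul, c0]

/-- `q = q₀²`. [folklore] -/
theorem q_eq_sq (m : ℕ) : qP m = q0 m ^ 2 := by rw [q_eq, q0, ← pow_mul]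

/-- `q₀ = h⁸ ≥ (m+2)⁸`. [folklore] -/
theorem q0_ge (m : ℕ) : (m + 2) ^ 8 ≤ q0 m := Nat.pow_le_pow_left (m_add_two_le_h m) 8

/-- `q ≥ (m+2)¹⁶`. [folklore] -/
theorem q_ge (m : ℕ) : (m + 2) ^ 16 ≤ qP m := by rw [q_eq]; exact Nat.pow_le_pow_left (m_add_two_le_h m) 16

/-- `h ≥ 2`. [folklore] -/
theorem two_le_h (m : ℕ) : 2 ≤ hP m := le_trans (by omega) (m_add_two_le_h m)

/-! ### `d` -/

/-- **`d` is a prime `≥ 17` with `hᵈ > n`, and `d ≤ 2 max 17 (log_h n + 1) + 2`.** [cite: Umans2003, §5, Lemma 7] -/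
theorem d_spec (n m : ℕ) : (dP n m).Prime ∧ c0 + 1 ≤ dP n m ∧ n < hP m ^ dP n m ∧ dP n m ≤ 2 * max (c0 + 1) (Nat.log (hP m) n + 1) + 2 := by
  obtain ⟨hp, hge, hle⟩ := nextPrimeL_spec (max (c0 + 1) (dBaseL (2 ^ aOf m) n))
  obtain ⟨hdb, hdbmin⟩ := dBaseL_spec (h := 2 ^ aOf m) (two_le_h m) n
  refine ⟨hp, le_trans (le_max_left _ _) hge, ?_, ?_⟩
  · exact hdb.trans_le (Nat.pow_le_pow_right (Nat.pow_pos (by norm_num)) (le_trans (le_max_right _ _) hge))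
  · refine hle.trans ?_
    have : dBaseL (2 ^ aOf m) n ≤ Nat.log (hP m) n + 1 := hdbmin _ (Nat.lt_pow_succ_log_self (two_le_h m) n)
    have hmax : max (c0 + 1) (dBaseL (2 ^ aOf m) n) ≤ max (c0 + 1) (Nat.log (hP m) n + 1) := max_le_max le_rfl this
    omega

/-- `d ≥ 17`, `d ≥ 1`. [folklore] -/
theorem d_ge (n m : ℕ) : 17 ≤ dP n m := (d_spec n m).2.1

/-- `gcd(16, d) = 1` (`d` is an odd prime). [cite: Umans2003, Lemma 7] -/
theorem coprime_c0_d (n m : ℕ) : Nat.Coprime c0 (dP n m) := by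
  obtain ⟨hp, hge, -⟩ := d_spec n m
  rw [c0, show (16 : ℕ) = 2 ^ 4 from rfl]
  refine Nat.Coprime.pow_left 4 ((Nat.coprime_primes Nat.prime_two hp).2 ?_)
  rw [c0] at hge; omega

/-- **`n ≤ hᵈ - 1`** (the positions are distinct). [cite: Umans2003, §4.1] -/
theorem n_le (n m : ℕ) : n ≤ hP m ^ dP n m - 1 := Nat.le_sub_one_of_lt (d_spec n m).2.2.1

/-- **In the regime, `d ≤ m`.** [cite: Umans2003, §5] -/
theorem d_le_m {n m : ℕ} (R : Regime n m) : dP n m ≤ m := by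
  obtain ⟨-, -, -, hle⟩ := d_spec n m
  have hlog : Nat.log (hP m) n ≤ Nat.log 2 n := Nat.log_anti_left (by norm_num) (two_le_h m)
  have h1 := R.hn
  have h2 := R.hm
  have : max (c0 + 1) (Nat.log (hP m) n + 1) ≤ max 17 (m / 4 + 1) := by rw [c0]; exact max_le_max le_rfl (by omega)
  have h3 : max 17 (m / 4 + 1) ≤ m / 4 + 17 := max_le (by omega) (by omega)
  omega

/-! ### The discrete inequalities of Lemma 13 / Thm. 14 in the regime -/

/-- `q ≥ m¹⁶`. [folklore] -/
theorem m16_le_q (m : ℕ) : m ^ 16 ≤ qP m := (Nat.pow_le_pow_left (by omega) 16).trans (q_ge m)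

namespace Regime

variable {n m : ℕ} (R : Regime n m)
include R

/-- `m ≥ 2`. [folklore] -/
theorem two_le_m : 2 ≤ m := le_trans (by norm_num) R.hm

omit R in
/-- `q ≥ m¹⁶`. [folklore] -/
theorem m16_le_q : m ^ 16 ≤ qP m := Prm.m16_le_q m

/-- `q ≥ 2⁴⁰ m¹⁴` (from `m ≥ 2²⁰`). [folklore] -/
theorem q_ge14 : 2 ^ 40 * m ^ 14 ≤ qP m := by
  have h := R.hm
  calc 2 ^ 40 * m ^ 14 = (2 ^ 20) ^ 2 * m ^ 14 := by norm_num
    _ ≤ m ^ 2 * m ^ 14 := Nat.mul_le_mul_right _ (Nat.pow_le_pow_left h 2)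
    _ = m ^ 16 := by ring
    _ ≤ qP m := Prm.m16_le_q m

/-- `4 m² A ≤ q` and `q < 4 m² (A + 1)` (the floor). [folklore] -/
theorem A_floor : 4 * m ^ 2 * AP m ≤ qP m ∧ qP m < 4 * m ^ 2 * (AP m + 1) := by
  have h0 : 0 < 4 * m ^ 2 := by have := R.two_le_m; positivity
  refine ⟨Nat.mul_div_le _ _, ?_⟩
  have := Nat.lt_div_mul_add (a := qP m) h0
  rw [AP]; linarith

/-- `A ≥ 2³⁷ m¹²` (so every polynomial-in-`m` quantity below fits under `A`). [folklore] -/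
theorem A_ge : 2 ^ 37 * m ^ 12 ≤ AP m := by
  have h1 := R.q_ge14
  have h2 := R.A_floor.2
  have hm : 1 ≤ m := le_trans (by norm_num) R.hm
  -- `4 m² (A + 1) > q ≥ 2⁴⁰ m¹⁴ = 4 m² · 2³⁸ m¹²`
  have h3 : 4 * m ^ 2 * (2 ^ 38 * m ^ 12) ≤ 4 * m ^ 2 * (AP m + 1) := by nlinarith
  have h4 : 2 ^ 38 * m ^ 12 ≤ AP m + 1 := Nat.le_of_mul_le_mul_left h3 (by positivity)
  have h5 : 1 ≤ 2 ^ 37 * m ^ 12 := by nlinarith [Nat.one_le_pow 12 m hm]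
  omega

/-- `D₁ = A ≥ 1`. [folklore] -/
theorem one_le_D1 : 1 ≤ D1 m := le_trans (by have := R.A_ge; nlinarith [Nat.one_le_pow 12 m (le_trans (by norm_num) R.hm)]) (le_of_eq rfl : AP m ≤ D1 m)

/-- **`hAD`**: `m² (A₁ q + q D₁) ≤ q²`. [cite: Umans2003, Lemma 13] -/
theorem hAD : m ^ 2 * (AP m * 2 ^ (MP m + 1) + 2 ^ (MP m + 1) * D1 m) ≤ 2 ^ (MP m + 1) * 2 ^ (MP m + 1) := by
  rw [← qP, D1, ← AP]
  have h := R.A_floor.1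
  nlinarith

/-- **`hℓ`**: `4^{M+1} ≤ ℓ₁ D₁²` (`q² ≤ 18 m⁴ ⌊q/(4m²)⌋²`). [cite: Umans2003, Lemma 13] -/
theorem hℓ : 4 ^ (MP m + 1) ≤ ℓ1 m * D1 m ^ 2 := by
  have e : 4 ^ (MP m + 1) = qP m ^ 2 := by rw [qP, ← pow_mul, show 4 = 2 ^ 2 from rfl, ← pow_mul, mul_comm]
  rw [e, ℓ1, D1, ← AP]
  obtain ⟨h1, h2⟩ := R.A_floor
  have hA := R.A_ge
  have hm := R.hm
  -- `q < 4m²(A+1)` and `A` huge: `q² < 16 m⁴ (A+1)² ≤ 18 m⁴ A²`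
  have h3 : qP m ^ 2 < (4 * m ^ 2 * (AP m + 1)) ^ 2 := Nat.pow_lt_pow_left h2 (by norm_num)
  have h4 : (4 * m ^ 2 * (AP m + 1)) ^ 2 ≤ 18 * m ^ 4 * AP m ^ 2 := by
    have hA17 : 17 ≤ AP m := le_trans (by nlinarith [Nat.one_le_pow 12 m (le_trans (by norm_num) hm)]) hA
    have : 16 * (AP m + 1) ^ 2 ≤ 18 * AP m ^ 2 := by nlinarith [Nat.mul_le_mul_right (AP m) hA17]
    calc (4 * m ^ 2 * (AP m + 1)) ^ 2 = m ^ 4 * (16 * (AP m + 1) ^ 2) := by ring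
      _ ≤ m ^ 4 * (18 * AP m ^ 2) := Nat.mul_le_mul_left _ this
      _ = 18 * m ^ 4 * AP m ^ 2 := by ring
  exact (h3.le.trans h4)

/-- `d ≤ m` and the coarse bounds `h ≤ 2m + 3`, `Dφ ≤ 3 m²`, `(d+1) r' - 1 ≤ 3 m²`, `D ≤ 9 m⁴`. [folklore] -/
theorem D_le : DP n m ≤ 9 * m ^ 4 := by
  have hd := d_le_m R
  have hh := h_lt m
  have hm := R.two_le_m
  have h20 := R.hm
  have h1 : DφP n m ≤ 3 * m ^ 2 := by
    rw [DφP]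
    calc dP n m * (hP m - 1) ≤ m * (2 * m + 3) := Nat.mul_le_mul hd (by omega)
      _ ≤ 3 * m ^ 2 := by nlinarith
  have h2 : (dP n m + 1) * r'P n m - 1 ≤ 3 * m ^ 2 := by
    rw [r'P]
    calc (dP n m + 1) * (2 * dP n m + 6) - 1 ≤ (m + 1) * (2 * m + 6) := (Nat.sub_le _ _).trans (Nat.mul_le_mul (by omega) (by omega))
      _ ≤ 3 * m ^ 2 := by nlinarith
  rw [DP]
  calc DφP n m * ((dP n m + 1) * r'P n m - 1) ≤ 3 * m ^ 2 * (3 * m ^ 2) := Nat.mul_le_mul h1 h2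
    _ = 9 * m ^ 4 := by ring

/-- **`hDq`**: `D < q`. [cite: Umans2003, Thm. 14 (proof)] -/
theorem hDq : DP n m < 2 ^ (MP m + 1) := by
  rw [← qP]
  have h1 := R.D_le
  have h2 := Prm.m16_le_q m
  have hm := R.two_le_m
  have : 9 * m ^ 4 < m ^ 16 := by
    calc 9 * m ^ 4 < 16 * m ^ 4 := by have := Nat.pow_pos (n := 4) (by omega : 0 < m); omega
      _ = 2 ^ 4 * m ^ 4 := by norm_num
      _ ≤ m ^ 4 * m ^ 4 := Nat.mul_le_mul_right _ (Nat.pow_le_pow_left hm 4)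
      _ ≤ m ^ 16 := by rw [← pow_add]; exact Nat.pow_le_pow_right (by omega) (by norm_num)
  omega

/-- `A ≥ J₁ d + 1` and `A ≥ J D + 1` (the subtractions defining `I₁`, `I` are exact). [folklore] -/
theorem A_ge_JD : J1 m * dP n m + 1 ≤ AP m ∧ JO m * DP n m + 1 ≤ AP m := by
  have hA := R.A_ge
  have hd := d_le_m R
  have hD := R.D_le
  have hm : 1 ≤ m := le_trans (by norm_num) R.hm
  have hm1 := Nat.one_le_pow 12 m hm
  have h712 : m ^ 7 ≤ m ^ 12 := Nat.pow_le_pow_right hm (by norm_num)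
  constructor
  · rw [J1]
    calc 128 * m ^ 6 * dP n m + 1 ≤ 128 * m ^ 6 * m + 1 := by have := Nat.mul_le_mul_left (128 * m ^ 6) hd; omega
      _ = 128 * m ^ 7 + 1 := by ring
      _ ≤ 2 ^ 37 * m ^ 12 := by omega
      _ ≤ AP m := hA
  · rw [JO]
    calc 2048 * m ^ 8 * DP n m + 1 ≤ 2048 * m ^ 8 * (9 * m ^ 4) + 1 := by have := Nat.mul_le_mul_left (2048 * m ^ 8) hD; omega
      _ = 18432 * m ^ 12 + 1 := by ring
      _ ≤ 2 ^ 37 * m ^ 12 := by omega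
      _ ≤ AP m := hA

/-- **`hA₁`**: `(I₁ - 1) + (J₁ - 1)(d - 1) < A₁`. [cite: Umans2003, Lemma 13] -/
theorem hA1 : (I1 n m - 1) + (J1 m - 1) * (dP n m - 1) < AP m := by
  have h := R.A_ge_JD.1
  have hd : 1 ≤ dP n m := le_trans (by norm_num) (d_ge n m)
  have hJ : 1 ≤ J1 m := by rw [J1]; nlinarith [Nat.one_le_pow 6 m (le_trans (by norm_num) R.hm)]
  rw [I1]
  have hle : J1 m * dP n m ≤ AP m := by omega
  have h1 : 1 ≤ AP m - J1 m * dP n m := by omega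
  zify [hle, h1, hd, hJ]
  nlinarith

/-- **`hA`**: `(I - 1) + (J - 1) D < A`. [cite: Umans2003, Lemma 15] -/
theorem hAO : (IO n m - 1) + (JO m - 1) * DP n m < AP m := by
  have h := R.A_ge_JD.2
  have hJ : 1 ≤ JO m := by rw [JO]; nlinarith [Nat.one_le_pow 8 m (le_trans (by norm_num) R.hm)]
  rw [IO]
  have hle : JO m * DP n m ≤ AP m := by omega
  have h1 : 1 ≤ AP m - JO m * DP n m := by omega
  zify [hle, h1, hJ]
  nlinarith

/-- **`hIJ₁`**: `q ℓ₁ < I₁ J₁`. [cite: Umans2003, Lemma 13] -/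
theorem hIJ1 : 2 ^ (MP m + 1) * ℓ1 m < I1 n m * J1 m := by
  rw [← qP, ℓ1, I1, J1]
  obtain ⟨h1, h2⟩ := R.A_floor
  have hd := d_le_m R
  have hq := R.q_ge14
  have hm : 1 ≤ m := le_trans (by norm_num) R.hm
  have hsub : 128 * m ^ 6 * dP n m ≤ AP m := by have := R.A_ge_JD.1; rw [J1] at this; omega
  zify [hsub]
  -- `I₁ J₁ = (A - 128 m⁶ d) 128 m⁶ ≥ (A - 128 m⁷)·128 m⁶` and `4m²(A+1) > q`
  have hm0 : (0 : ℤ) < m := by exact_mod_cast (lt_of_lt_of_le (by norm_num) R.hm)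
  have hA' : (qP m : ℤ) + 1 ≤ 4 * m ^ 2 * (AP m + 1) := by exact_mod_cast h2
  have hdm : (dP n m : ℤ) ≤ m := by exact_mod_cast hd
  have hq' : (2 : ℤ) ^ 40 * m ^ 14 ≤ qP m := by exact_mod_cast hq
  have h5 := mul_le_mul_of_nonneg_left hA' (by positivity : (0 : ℤ) ≤ 32 * m ^ 4)
  have h6 := mul_le_mul_of_nonneg_left hdm (by positivity : (0 : ℤ) ≤ m ^ 12)
  have h7 := mul_le_mul_of_nonneg_left hq' (by positivity : (0 : ℤ) ≤ m ^ 4)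
  have hm1 : (1 : ℤ) ≤ m := by exact_mod_cast hm
  have h8 : (m : ℤ) ^ 6 ≤ m ^ 18 := pow_le_pow_right₀ hm1 (by norm_num)
  have h9 : (m : ℤ) ^ 13 ≤ m ^ 18 := pow_le_pow_right₀ hm1 (by norm_num)
  nlinarith [pow_pos hm0 18, pow_pos hm0 4]

/-- **`hIJ`**: `q · max 1 J₁ < I J`. [cite: Umans2003, Lemma 15] -/
theorem hIJO : 2 ^ (MP m + 1) * (max 1 (J1 m)) < IO n m * JO m := by
  have hJ : 1 ≤ J1 m := by rw [J1]; nlinarith [Nat.one_le_pow 6 m (le_trans (by norm_num) R.hm)]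
  rw [max_eq_right hJ, ← qP, J1, IO, JO]
  obtain ⟨h1, h2⟩ := R.A_floor
  have hD := R.D_le
  have hq := R.q_ge14
  have hsub : 2048 * m ^ 8 * DP n m ≤ AP m := by have := R.A_ge_JD.2; rw [JO] at this; omega
  zify [hsub]
  have hm0 : (0 : ℤ) < m := by exact_mod_cast (lt_of_lt_of_le (by norm_num) R.hm)
  have hA' : (qP m : ℤ) + 1 ≤ 4 * m ^ 2 * (AP m + 1) := by exact_mod_cast h2
  have hD' : (DP n m : ℤ) ≤ 9 * m ^ 4 := by exact_mod_cast hD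
  have hq' : (2 : ℤ) ^ 40 * m ^ 14 ≤ qP m := by exact_mod_cast hq
  have h5 := mul_le_mul_of_nonneg_left hA' (by positivity : (0 : ℤ) ≤ 512 * m ^ 6)
  have h6 := mul_le_mul_of_nonneg_left hD' (by positivity : (0 : ℤ) ≤ m ^ 16)
  have h7 := mul_le_mul_of_nonneg_left hq' (by positivity : (0 : ℤ) ≤ m ^ 6)
  have hm1 : (1 : ℤ) ≤ m := by exact_mod_cast (le_trans (by norm_num) R.hm : 1 ≤ m)
  have h8 : (m : ℤ) ^ 6 ≤ m ^ 20 := pow_le_pow_right₀ hm1 (by norm_num)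
  have h9 : (m : ℤ) ^ 8 ≤ m ^ 20 := pow_le_pow_right₀ hm1 (by norm_num)
  nlinarith [pow_pos hm0 6, pow_pos hm0 8, pow_pos hm0 20]

end Regime

/-! ### The probabilistic inequality of Thm. 14 (`hsmall`) -/

/-- **The union bound of Thm. 14 holds for the chosen parameters** (abstract real form): with
`q = q₀²`, `r' = 2d + 6`, `r = (d+1) r' = 2k`, `k = (d+1)(d+3)`, `P < q^d`, density `μ ≥ q/(2m²)`
and `Emb ≥ (q - r)^r` node embeddings, the three failure terms are each at most `Emb/4`.
[cite: Umans2003, Thm. 14 (proof: "the probability … is less than 1"), §5] -/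
theorem hsmall_real {q q0 d r' k J D m P : ℕ} (hq : q = q0 ^ 2) (hr' : r' = 2 * d + 6) (hk : k = (d + 1) * (d + 3))
    (hP : P < q ^ d) (hd : 1 ≤ d) (hm : 1 ≤ m) (hq0 : 8 * k ^ 2 * m ^ 2 ≤ q0) (hq1 : 8 * d * (k + 1) ≤ q) (hqD : 8 * D ≤ q0)
    (hqr : 2 * ((d + 1) * ((d + 1) * r')) ≤ q) (hJ : 8 * d ^ 2 * J ≤ 4 ^ r' * q0 ^ 6) (hq4 : 4 ≤ q ^ d)
    {μ Emb : ℝ} (hμ : (q : ℝ) / (2 * m ^ 2) ≤ μ) (hEmb : ((q : ℝ) - (d + 1) * r') ^ ((d + 1) * r') ≤ Emb) (hEmb0 : 0 < Emb) :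
    (P : ℝ) * d *
        (2 * Emb * (2 ^ ((d + 1) * r') * ((((d + 1) * r' / 2 : ℕ) + 1 : ℝ) * (((d + 1) * r' / 2 : ℕ) : ℝ) ^ ((d + 1) * r') *
              μ ^ ((d + 1) * r' / 2))) / μ ^ ((d + 1) * r') +
          2 * d * ((J - 1 : ℕ) : ℝ) * ((D : ℝ) ^ r' * (q : ℝ) ^ (d * r'))) +
        Emb / (q : ℝ) ^ d < Emb := by
  -- rewrite `(d+1) r' = 2 k`
  have hr2 : (d + 1) * r' = 2 * k := by rw [hr', hk]; ring
  have hk2 : (d + 1) * r' / 2 = k := by rw [hr2]; omega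
  rw [hk2]
  -- positivity facts
  have hq0pos : 0 < q0 := by
    have : 1 ≤ 8 * k ^ 2 * m ^ 2 := by rw [hk]; nlinarith [Nat.one_le_pow 2 m hm]
    omega
  have hqpos : (0 : ℝ) < q := by rw [hq]; positivity
  have hm2 : (0 : ℝ) < 2 * (m : ℝ) ^ 2 := by positivity
  have hμ0 : 0 < μ := lt_of_lt_of_le (div_pos hqpos hm2) hμ
  have hkpos : 0 < k := by rw [hk]; positivity
  -- (i) the first term: `8 P d Φ ≤ μ^r`, i.e. `8 P d (k+1) (4k²)^k μ^k ≤ μ^{2k}`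
  have hI : (P : ℝ) * d * (2 * Emb * (2 ^ ((d + 1) * r') * (((k : ℕ) + 1 : ℝ) * ((k : ℕ) : ℝ) ^ ((d + 1) * r') * μ ^ k))) / μ ^ ((d + 1) * r') ≤ Emb / 4 := by
    rw [hr2]
    -- `μ^{2k} = μ^k μ^k`, and `μ^k ≥ (q/(2m²))^k`
    have hμk : ((q : ℝ) / (2 * m ^ 2)) ^ k ≤ μ ^ k := pow_le_pow_left₀ (by positivity) hμ k
    have e1 : (2 : ℝ) ^ (2 * k) * ((k : ℝ) ^ (2 * k)) = ((4 : ℝ) * k ^ 2) ^ k := by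
      rw [mul_pow, pow_mul, pow_mul]; norm_num
    -- the key natural-number inequality: `8 P d (k+1) (8 k² m²)^k ≤ q^k`
    have hnat : 8 * P * d * (k + 1) * (8 * k ^ 2 * m ^ 2) ^ k ≤ q ^ k := by
      -- `q^k = q^d q^{k-d}`, `k - d = d² + 3d + 3 ≥ 1 + (d²+3d+2)` and `q^{d²+3d+2} ≥ q0^k`
      have hkd : k = d + (1 + (d ^ 2 + 3 * d + 2)) := by rw [hk]; ring
      have hle : k ≤ 2 * (d ^ 2 + 3 * d + 2) := by rw [hk]; nlinarith
      calc 8 * P * d * (k + 1) * (8 * k ^ 2 * m ^ 2) ^ k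
          ≤ (8 * d * (k + 1)) * P * q0 ^ k := by
            have h1 : (8 * k ^ 2 * m ^ 2) ^ k ≤ q0 ^ k := Nat.pow_le_pow_left hq0 k
            calc 8 * P * d * (k + 1) * (8 * k ^ 2 * m ^ 2) ^ k = (8 * d * (k + 1)) * P * (8 * k ^ 2 * m ^ 2) ^ k := by ring
              _ ≤ (8 * d * (k + 1)) * P * q0 ^ k := Nat.mul_le_mul_left _ h1
        _ ≤ q * q ^ d * q0 ^ (2 * (d ^ 2 + 3 * d + 2)) := by
            refine Nat.mul_le_mul (Nat.mul_le_mul hq1 hP.le) (Nat.pow_le_pow_right hq0pos hle)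
        _ = q ^ k := by
            rw [pow_mul, ← hq, hkd]; ring
    have hreal : (8 : ℝ) * P * d * (k + 1) * (8 * (k : ℝ) ^ 2 * (m : ℝ) ^ 2) ^ k ≤ (q : ℝ) ^ k := by exact_mod_cast hnat
    -- `(q/(2m²))^k (2m²)^k = q^k`
    have e2 : ((q : ℝ) / (2 * m ^ 2)) ^ k * ((2 : ℝ) * m ^ 2) ^ k = (q : ℝ) ^ k := by
      rw [← mul_pow, div_mul_cancel₀ _ hm2.ne']
    have e3 : (8 * (k : ℝ) ^ 2 * (m : ℝ) ^ 2) ^ k = ((4 : ℝ) * k ^ 2) ^ k * ((2 : ℝ) * m ^ 2) ^ k := by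
      rw [← mul_pow]; congr 1; ring
    -- hence `8 P d (k+1) (4k²)^k ≤ (q/(2m²))^k ≤ μ^k`
    have h4 : (8 : ℝ) * P * d * (k + 1) * ((4 : ℝ) * k ^ 2) ^ k ≤ μ ^ k := by
      have hpos : (0 : ℝ) < ((2 : ℝ) * m ^ 2) ^ k := by positivity
      have : (8 : ℝ) * P * d * (k + 1) * ((4 : ℝ) * k ^ 2) ^ k * ((2 : ℝ) * m ^ 2) ^ k ≤ ((q : ℝ) / (2 * m ^ 2)) ^ k * ((2 : ℝ) * m ^ 2) ^ k := by
        rw [e2, mul_assoc, ← e3]; exact hreal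
      exact (le_of_mul_le_mul_right this hpos).trans hμk
    -- assemble
    rw [div_le_div_iff₀ (by positivity) (by norm_num : (0 : ℝ) < 4), show μ ^ (2 * k) = μ ^ k * μ ^ k by rw [two_mul, pow_add]]
    have : (P : ℝ) * d * (2 * Emb * (2 ^ (2 * k) * (((k : ℕ) + 1 : ℝ) * ((k : ℕ) : ℝ) ^ (2 * k) * μ ^ k))) * 4 =
        Emb * μ ^ k * ((8 : ℝ) * P * d * (k + 1) * (2 ^ (2 * k) * (k : ℝ) ^ (2 * k))) := by ring
    rw [this, e1]
    have hE : 0 ≤ Emb * μ ^ k := by positivity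
    calc Emb * μ ^ k * ((8 : ℝ) * P * d * (k + 1) * ((4 : ℝ) * k ^ 2) ^ k) ≤ Emb * μ ^ k * μ ^ k := mul_le_mul_of_nonneg_left h4 hE
      _ = Emb * (μ ^ k * μ ^ k) := by ring
  -- (ii) the second term: `8 P d² J D^{r'} q^{d r'} ≤ (q - r)^r ≤ Emb`
  have hII : (P : ℝ) * d * (2 * d * ((J - 1 : ℕ) : ℝ) * ((D : ℝ) ^ r' * (q : ℝ) ^ (d * r'))) ≤ Emb / 4 := by
    -- Bernoulli: `(q - r)^{d+1} ≥ q^{d+1} - (d+1) r q^d ≥ q^d (q/2)`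
    set rr : ℝ := (d + 1 : ℝ) * r' with hrr
    have hrq : rr ≤ (q : ℝ) / 2 := by
      have : (2 * ((d + 1) * ((d + 1) * r')) : ℝ) ≤ q := by exact_mod_cast hqr
      rw [hrr]; nlinarith [show (0:ℝ) ≤ (d + 1 : ℝ) * r' by positivity, show (1 : ℝ) ≤ d + 1 by linarith [show (0:ℝ) ≤ d from Nat.cast_nonneg d]]
    have hrq' : (d + 1 : ℝ) * rr ≤ (q : ℝ) / 2 := by
      have : (2 * ((d + 1) * ((d + 1) * r')) : ℝ) ≤ q := by exact_mod_cast hqr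
      rw [hrr]; linarith
    have hbern : (q : ℝ) ^ d * ((q : ℝ) / 2) ≤ ((q : ℝ) - rr) ^ (d + 1) := by
      have hx : 0 ≤ 2 + (-(rr / q)) := by
        have : rr / q ≤ 1 / 2 := by rw [div_le_iff₀ hqpos]; linarith
        linarith
      have h1 := one_add_le_pow_of_two_add_nonneg hx (d + 1)
      have e : ((q : ℝ) - rr) ^ (d + 1) = (q : ℝ) ^ (d + 1) * (1 + -(rr / q)) ^ (d + 1) := by
        rw [← mul_pow]; congr 1; field_simp; ring
      rw [e]
      have h2 : (q : ℝ) ^ d * ((q : ℝ) / 2) ≤ (q : ℝ) ^ (d + 1) * (1 + (d + 1 : ℕ) * -(rr / q)) := by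
        have e2 : (q : ℝ) ^ (d + 1) * (1 + (d + 1 : ℕ) * -(rr / q)) = (q : ℝ) ^ d * (q - (d + 1 : ℕ) * rr) := by
          rw [pow_succ]; field_simp; ring
        rw [e2]
        refine mul_le_mul_of_nonneg_left ?_ (by positivity)
        push_cast; linarith
      exact h2.trans (mul_le_mul_of_nonneg_left h1 (by positivity))
    -- `(q - r)^r = ((q - r)^{d+1})^{r'} ≥ (q^d q/2)^{r'}`
    have hqr0 : 0 ≤ (q : ℝ) ^ d * ((q : ℝ) / 2) := by positivity
    have hpow : ((q : ℝ) ^ d * ((q : ℝ) / 2)) ^ r' ≤ Emb := by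
      calc ((q : ℝ) ^ d * ((q : ℝ) / 2)) ^ r' ≤ (((q : ℝ) - rr) ^ (d + 1)) ^ r' := pow_le_pow_left₀ hqr0 hbern r'
        _ = ((q : ℝ) - (d + 1) * r') ^ ((d + 1) * r') := by rw [← pow_mul, hrr]
        _ ≤ Emb := hEmb
    -- the natural-number inequality `8 P d² J (2D)^{r'} ≤ q0^{r'} q0^{r'}` (via `q0 ≥ 8D`, `hJ`, `P < q^d`)
    have e2 : q0 ^ r' = q ^ d * q0 ^ 6 := by rw [hr', pow_add, pow_mul, ← hq]
    have hnat : 8 * P * d ^ 2 * J * (2 * D) ^ r' ≤ q0 ^ r' * q0 ^ r' := by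
      have h1 : (2 * D) ^ r' * 4 ^ r' ≤ q0 ^ r' := by rw [← mul_pow]; exact Nat.pow_le_pow_left (by omega) r'
      calc 8 * P * d ^ 2 * J * (2 * D) ^ r' = P * (8 * d ^ 2 * J) * (2 * D) ^ r' := by ring
        _ ≤ q ^ d * (4 ^ r' * q0 ^ 6) * (2 * D) ^ r' := Nat.mul_le_mul_right _ (Nat.mul_le_mul hP.le hJ)
        _ = (q ^ d * q0 ^ 6) * ((2 * D) ^ r' * 4 ^ r') := by ring
        _ ≤ q0 ^ r' * q0 ^ r' := by rw [← e2]; exact Nat.mul_le_mul_left _ h1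
    have hreal : (8 : ℝ) * P * (d : ℝ) ^ 2 * J * ((2 : ℝ) * D) ^ r' ≤ (q0 : ℝ) ^ r' * (q0 : ℝ) ^ r' := by exact_mod_cast hnat
    -- pass to the real bound
    have hJ1 : ((J - 1 : ℕ) : ℝ) ≤ J := by exact_mod_cast Nat.sub_le J 1
    have hqd0 : (0 : ℝ) ≤ (q : ℝ) ^ (d * r') := by positivity
    have hstep1 : (P : ℝ) * d * (2 * d * ((J - 1 : ℕ) : ℝ) * ((D : ℝ) ^ r' * (q : ℝ) ^ (d * r'))) ≤
        2 * P * (d : ℝ) ^ 2 * J * (D : ℝ) ^ r' * (q : ℝ) ^ (d * r') := by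
      have : (P : ℝ) * d * (2 * d * ((J - 1 : ℕ) : ℝ) * ((D : ℝ) ^ r' * (q : ℝ) ^ (d * r'))) =
          (2 * P * (d : ℝ) ^ 2 * (D : ℝ) ^ r' * (q : ℝ) ^ (d * r')) * ((J - 1 : ℕ) : ℝ) := by ring
      rw [this]
      calc (2 * P * (d : ℝ) ^ 2 * (D : ℝ) ^ r' * (q : ℝ) ^ (d * r')) * ((J - 1 : ℕ) : ℝ)
          ≤ (2 * P * (d : ℝ) ^ 2 * (D : ℝ) ^ r' * (q : ℝ) ^ (d * r')) * J := mul_le_mul_of_nonneg_left hJ1 (by positivity)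
        _ = _ := by ring
    refine hstep1.trans ?_
    rw [le_div_iff₀ (by norm_num : (0 : ℝ) < 4)]
    -- `8 P d² J D^{r'} q^{dr'} ≤ (q^d q/2)^{r'} ≤ Emb`
    refine le_trans ?_ hpow
    have e3 : ((q : ℝ) ^ d * ((q : ℝ) / 2)) ^ r' * (2 : ℝ) ^ r' = (q : ℝ) ^ (d * r') * ((q0 : ℝ) ^ r' * (q0 : ℝ) ^ r') := by
      rw [← mul_pow, ← mul_pow, ← sq, pow_mul]
      have : (q : ℝ) = (q0 : ℝ) ^ 2 := by exact_mod_cast hq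
      rw [this]; ring
    have h2pos : (0 : ℝ) < (2 : ℝ) ^ r' := by positivity
    apply le_of_mul_le_mul_right _ h2pos
    rw [e3]
    calc 2 * P * (d : ℝ) ^ 2 * J * (D : ℝ) ^ r' * (q : ℝ) ^ (d * r') * 4 * (2 : ℝ) ^ r'
        = (q : ℝ) ^ (d * r') * ((8 : ℝ) * P * (d : ℝ) ^ 2 * J * ((2 : ℝ) * D) ^ r') := by rw [mul_pow]; ring
      _ ≤ (q : ℝ) ^ (d * r') * ((q0 : ℝ) ^ r' * (q0 : ℝ) ^ r') := mul_le_mul_of_nonneg_left hreal hqd0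
  -- (iii) the third term
  have hIII : Emb / (q : ℝ) ^ d ≤ Emb / 4 := by
    have : (4 : ℝ) ≤ (q : ℝ) ^ d := by exact_mod_cast hq4
    exact div_le_div_of_nonneg_left hEmb0.le (by norm_num) this
  -- sum
  have hsum := add_le_add (add_le_add hI hII) hIII
  have e : (P : ℝ) * d *
        (2 * Emb * (2 ^ ((d + 1) * r') * (((k : ℕ) + 1 : ℝ) * ((k : ℕ) : ℝ) ^ ((d + 1) * r') * μ ^ k)) / μ ^ ((d + 1) * r') +
          2 * d * ((J - 1 : ℕ) : ℝ) * ((D : ℝ) ^ r' * (q : ℝ) ^ (d * r'))) =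
      (P : ℝ) * d * (2 * Emb * (2 ^ ((d + 1) * r') * (((k : ℕ) + 1 : ℝ) * ((k : ℕ) : ℝ) ^ ((d + 1) * r') * μ ^ k))) / μ ^ ((d + 1) * r') +
        (P : ℝ) * d * (2 * d * ((J - 1 : ℕ) : ℝ) * ((D : ℝ) ^ r' * (q : ℝ) ^ (d * r'))) := by ring
  rw [e]
  linarith

namespace Regime

variable {n m : ℕ} (R : Regime n m)
include R

/-- `k ≤ (m+2)²`. [folklore] -/
theorem k_le : kP n m ≤ (m + 2) ^ 2 := by
  have hd := d_le_m R
  rw [kP]; nlinarith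

/-- **`hsmall` for the chosen parameters** (given the density and the embedding count).
[cite: Umans2003, Thm. 14, §5] -/
theorem hsmall {μ Emb : ℝ} (hμ : (qP m : ℝ) / (2 * m ^ 2) ≤ μ)
    (hEmb : ((qP m : ℝ) - (dP n m + 1) * r'P n m) ^ ((dP n m + 1) * r'P n m) ≤ Emb) (hEmb0 : 0 < Emb) :
    (((2 ^ (MP m + 1)) ^ dP n m - 1 : ℕ) : ℝ) * dP n m *
        (2 * Emb * (2 ^ ((dP n m + 1) * r'P n m) * ((((dP n m + 1) * r'P n m / 2 : ℕ) + 1 : ℝ) *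
            (((dP n m + 1) * r'P n m / 2 : ℕ) : ℝ) ^ ((dP n m + 1) * r'P n m) * μ ^ ((dP n m + 1) * r'P n m / 2))) / μ ^ ((dP n m + 1) * r'P n m) +
          2 * dP n m * ((JO m - 1 : ℕ) : ℝ) * ((DP n m : ℝ) ^ r'P n m * ((2 ^ (MP m + 1) : ℕ) : ℝ) ^ (dP n m * r'P n m))) +
        Emb / ((2 ^ (MP m + 1) : ℕ) : ℝ) ^ dP n m < Emb := by
  have hm1 : 1 ≤ m := le_trans (by norm_num) R.hm
  have hm := R.hm
  have hd := d_le_m R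
  have hd1 : 1 ≤ dP n m := le_trans (by norm_num) (d_ge n m)
  have hk := R.k_le
  have hq0 := q0_ge m
  have hq := Prm.m16_le_q m
  have hD := R.D_le
  have hm2 : 8 ≤ (m + 2) ^ 2 := by nlinarith
  -- the side conditions of `hsmall_real`
  have c1 : 8 * kP n m ^ 2 * m ^ 2 ≤ q0 m := by
    calc 8 * kP n m ^ 2 * m ^ 2 ≤ 8 * ((m + 2) ^ 2) ^ 2 * (m + 2) ^ 2 := by gcongr; omega
      _ = 8 * (m + 2) ^ 6 := by ring
      _ ≤ (m + 2) ^ 2 * (m + 2) ^ 6 := Nat.mul_le_mul_right _ hm2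
      _ = (m + 2) ^ 8 := by ring
      _ ≤ q0 m := hq0
  have c2 : 8 * dP n m * (kP n m + 1) ≤ qP m := by
    calc 8 * dP n m * (kP n m + 1) ≤ 8 * m * ((m + 2) ^ 2 + 1) := by gcongr
      _ ≤ 80 * m ^ 3 := by nlinarith [Nat.one_le_pow 2 m hm1, Nat.one_le_pow 3 m hm1]
      _ ≤ m * m ^ 3 := Nat.mul_le_mul_right _ (le_trans (by norm_num) hm)
      _ = m ^ 4 := by ring
      _ ≤ m ^ 16 := Nat.pow_le_pow_right hm1 (by norm_num)
      _ ≤ qP m := hq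
  have c3 : 8 * DP n m ≤ q0 m := by
    have h72 : 72 ≤ m ^ 4 := le_trans (by norm_num) (Nat.pow_le_pow_left hm 4)
    calc 8 * DP n m ≤ 8 * (9 * m ^ 4) := Nat.mul_le_mul_left _ hD
      _ = 72 * m ^ 4 := by ring
      _ ≤ m ^ 4 * m ^ 4 := Nat.mul_le_mul_right _ h72
      _ = m ^ 8 := by ring
      _ ≤ (m + 2) ^ 8 := Nat.pow_le_pow_left (by omega) 8
      _ ≤ q0 m := hq0
  have c4 : 2 * ((dP n m + 1) * ((dP n m + 1) * r'P n m)) ≤ qP m := by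
    rw [r'P]
    calc 2 * ((dP n m + 1) * ((dP n m + 1) * (2 * dP n m + 6))) ≤ 2 * ((m + 1) * ((m + 1) * (2 * m + 6))) := by gcongr
      _ ≤ m ^ 16 := by nlinarith [pow_le_pow_right₀ hm1 (by norm_num : 4 ≤ 16), Nat.one_le_pow 4 m hm1]
      _ ≤ qP m := hq
  have c5 : 8 * dP n m ^ 2 * JO m ≤ 4 ^ r'P n m * q0 m ^ 6 := by
    rw [JO]
    calc 8 * dP n m ^ 2 * (2048 * m ^ 8) ≤ 8 * m ^ 2 * (2048 * m ^ 8) := by gcongr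
      _ = 2 ^ 14 * m ^ 10 := by ring
      _ ≤ 1 * (m + 2) ^ 48 := by
          rw [one_mul]
          calc 2 ^ 14 * m ^ 10 ≤ (m + 2) ^ 14 * (m + 2) ^ 10 := Nat.mul_le_mul (Nat.pow_le_pow_left (by omega) 14) (Nat.pow_le_pow_left (by omega) 10)
            _ = (m + 2) ^ 24 := by ring
            _ ≤ (m + 2) ^ 48 := Nat.pow_le_pow_right (by omega) (by norm_num)
      _ ≤ 4 ^ r'P n m * q0 m ^ 6 := Nat.mul_le_mul (Nat.one_le_pow _ _ (by norm_num)) (by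
          calc (m + 2) ^ 48 = ((m + 2) ^ 8) ^ 6 := by ring
            _ ≤ q0 m ^ 6 := Nat.pow_le_pow_left hq0 6)
  have c6 : 4 ≤ qP m ^ dP n m := by
    calc 4 ≤ m := le_trans (by norm_num) hm
      _ ≤ m ^ 16 := Nat.le_self_pow (by norm_num) m
      _ ≤ qP m := hq
      _ ≤ qP m ^ dP n m := Nat.le_self_pow (by omega) _
  have hP : qP m ^ dP n m - 1 < qP m ^ dP n m := Nat.sub_lt (by omega) Nat.one_pos
  have h := hsmall_real (q_eq_sq m) (rfl : r'P n m = 2 * dP n m + 6) (rfl : kP n m = (dP n m + 1) * (dP n m + 3)) hP hd1 hm1 c1 c2 c3 c4 c5 c6 hμ hEmb hEmb0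
  rw [qP] at h
  push_cast at h ⊢
  exact h

end Regime

end Prm

end UmansFP

end Literature.Computability.Complexity

end
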